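import Summits.Langlands.Langlands.Theorems.IrreducibilityBySelfDualityPairLBoundaryJSGapGlobalTranslatePart1

/-!
# The gap global theorem in TRANSLATE form for `GL_n × GL_m` — part 2: integrability of the pair integrand from the
# one-factor lintegral

Summit `Langlands`, sub-problem `Langlands`, helper file under `Theorems/` supporting the crux `PairLBoundaryJS`
(stmt-Langlands-13622), line `Sketch`, registered sub-stub `stub_gap_pair_integrable` of `stub_gap_global_translate`
(G-GT, gap road, lead c6): for continuous `W` on `GL_n(𝔸_K)`, `W'` on `GL_m(𝔸_K)` with `‖W'‖ ≤ M` and a finite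
one-factor lintegral `∫⁻ ‖W(ι(diag(a)k))‖ |det a|^{re s} δ⁻¹ < ∞` (`ι = glCorner (m ≤ n)`), the pair integrand
`torusPairIntegrandC m K (W ∘ ι) (star ∘ W') 1 s` is integrable (the integrability step of
`CornerGlobalTranslate.jpssIntegral_star_eq`, isolated). [cite: CogdellAnalyticTheory2004, §2.2–2.3]

## References

* J. W. Cogdell, *Analytic theory of L-functions for GL_n*, in *An Introduction to the Langlands
  Program* (2004), §2.2–2.3 [CogdellAnalyticTheory2004].
-/

noncomputable section

-- `Summit.Langlands.Langlands.…` (summit = sub-problem name, D-0017 layout) trips `dupNamespace`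
set_option linter.dupNamespace false

open scoped MatrixGroups Topology Pointwise ENNReal NNReal ComplexConjugate InnerProductSpace ContDiff
-- the place subtypes indexing `mixedSpace K` are `Fintype` classically (`NormedCommRing (mixedSpace K)`)
open scoped Classical Matrix.Norms.Operator
open NumberField IsDedekindDomain MeasureTheory Measure Matrix Set Filter WithZero
open NumberField.mixedEmbedding
open Literature.NumberTheory.Automorphic AdelicGroupData
open Literature.NumberTheory.GaloisRepresentations (ideleGroup HeckeCharacter)
open Literature.MeasureTheory.Group
open Literature.RingTheory.SymmetricFunctions.SymmPoly
open ValuativeRel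

-- the automorphic quotient carries the tree's Borel σ-algebra, not Mathlib's quotient σ-algebra
attribute [-instance] Quotient.instMeasurableSpace QuotientGroup.measurableSpace

-- the house local instances, exactly as in `RankinSelbergUnfoldingIdentity`
attribute [local instance] adelicBorel borelSpace_adelic locallyCompactSpace_adelic secondCountableTopology_gl_adelic
  glAdeleBorel borelSpace_glAdele borelSpace_ideleGroup secondCountableTopology_ideleGroup

-- Mathlib idiom: the commutator Lie ring on matrices, to mention `(archGroupGL n K).lie`
attribute [local instance 100] LieRing.ofAssociativeRing

namespace Summit.Langlands.Langlands.Theorems.GapGlobalTranslatePart2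

section Main

variable {n m : ℕ} {K : Type} [Field K] [NumberField K]
  [MeasurableSpace (AdeleRing (𝓞 K) K)] [BorelSpace (AdeleRing (𝓞 K) K)]

local notation "𝔸" => AdeleRing (𝓞 K) K

/-- **The pair integrand is integrable when the one-factor lintegral is finite and the second factor is bounded**
(`‖W ∘ ι‖ · ‖W'‖ · w_σ ≤ M · ‖W ∘ ι‖ · w_σ`). [folklore] -/
theorem integrable_pair_of_lintegral (hmn : m ≤ n)
    (νA : Measure (Fin m → ideleGroup K)) (νK : Measure ↥(maximalCompactAdelic m K))
    {W : GL (Fin n) 𝔸 → ℂ} {W' : GL (Fin m) 𝔸 → ℂ} (hWc : Continuous W) (hW'c : Continuous W')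
    {M : ℝ} (hM0 : 0 ≤ M) (hW'b : ∀ g, ‖W' g‖ ≤ M) {s : ℂ}
    (hfinW : ∫⁻ p, ‖W (glCorner 𝔸 hmn (torusPoint m K p))‖ₑ *
        ENNReal.ofReal (torusWeight m K s.re p.1) ∂(νA.prod νK) < ⊤) :
    Integrable (torusPairIntegrandC m K (fun g => W (glCorner 𝔸 hmn g)) (fun g => star (W' g)) (fun _ => (1 : ℝ)) s)
      (νA.prod νK) := by
  haveI : T2Space (GL (Fin m) 𝔸) := t2Space_gl m K
  haveI : LocallyCompactSpace (GL (Fin m) 𝔸) :=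
    AdelicGroupData.locallyCompactSpace_generalLinearGroup_adeleRing K (Fin m)
  haveI : SecondCountableTopology (GL (Fin m) 𝔸) := secondCountableTopology_generalLinearGroup_adeleRing K (Fin m)
  haveI : SecondCountableTopology (AdelicGroupData.gl m K).Adelic :=
    secondCountableTopology_generalLinearGroup_adeleRing K (Fin m)
  haveI : SecondCountableTopology ↥(maximalCompactAdelic m K) := TopologicalSpace.Subtype.secondCountableTopology _
  haveI := locallyCompactSpace_ideleGroup K
  have hpt : Measurable (torusPoint m K) := continuous_torusPoint.measurable
  have hI₁m : Measurable (torusPairIntegrandC m K (fun g => W (glCorner 𝔸 hmn g)) (fun g => star (W' g))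
      (fun _ => (1 : ℝ)) s) :=
    measurable_torusPairIntegrandC ((hWc.comp (continuous_glCorner _)).measurable.comp hpt)
      (hW'c.star.measurable.comp hpt) measurable_const _
  refine ⟨hI₁m.aestronglyMeasurable, ?_⟩
  have hRL : ∫⁻ p, ENNReal.ofReal M * (‖W (glCorner 𝔸 hmn (torusPoint m K p))‖ₑ *
      ENNReal.ofReal (torusWeight m K s.re p.1)) ∂(νA.prod νK) < ⊤ := by
    rw [lintegral_const_mul' _ _ ENNReal.ofReal_ne_top]
    exact ENNReal.mul_lt_top ENNReal.ofReal_lt_top hfinW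
  refine lt_of_le_of_lt (lintegral_mono fun p => ?_) hRL
  rw [← ofReal_norm, ← ofReal_norm, ← ENNReal.ofReal_mul (norm_nonneg _), ← ENNReal.ofReal_mul hM0]
  refine ENNReal.ofReal_le_ofReal ?_
  rw [norm_torusPairIntegrandC, abs_one, mul_one]
  calc ‖W (glCorner 𝔸 hmn (torusPoint m K p))‖ * ‖star (W' (torusPoint m K p))‖ * torusWeight m K s.re p.1
      ≤ ‖W (glCorner 𝔸 hmn (torusPoint m K p))‖ * M * torusWeight m K s.re p.1 :=
        mul_le_mul_of_nonneg_right (mul_le_mul_of_nonneg_left (by rw [norm_star]; exact hW'b _)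
          (norm_nonneg _)) (torusWeight_nonneg _ _)
    _ = M * (‖W (glCorner 𝔸 hmn (torusPoint m K p))‖ * torusWeight m K s.re p.1) := by ring

/-- **SUB-STUB (G-GT, integrability) — the pair integrand is integrable when the one-factor lintegral is finite and
the second factor is bounded** (registered form of `integrable_pair_of_lintegral`). [folklore] -/
theorem stub_gap_pair_integrable :
    ∀ {n m : ℕ} {K : Type} [Field K] [NumberField K]
      [MeasurableSpace (AdeleRing (𝓞 K) K)] [BorelSpace (AdeleRing (𝓞 K) K)] (hmn : m ≤ n)
      (νA : Measure (Fin m → ideleGroup K)) (νK : Measure ↥(maximalCompactAdelic m K))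
      {W : GL (Fin n) (AdeleRing (𝓞 K) K) → ℂ} {W' : GL (Fin m) (AdeleRing (𝓞 K) K) → ℂ},
      Continuous W → Continuous W' → ∀ {M : ℝ}, 0 ≤ M → (∀ g, ‖W' g‖ ≤ M) → ∀ {s : ℂ},
      ∫⁻ p, ‖W (glCorner (AdeleRing (𝓞 K) K) hmn (torusPoint m K p))‖ₑ *
          ENNReal.ofReal (torusWeight m K s.re p.1) ∂(νA.prod νK) < ⊤ →
      Integrable (torusPairIntegrandC m K (fun g => W (glCorner (AdeleRing (𝓞 K) K) hmn g))
        (fun g => star (W' g)) (fun _ => (1 : ℝ)) s) (νA.prod νK) := by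
  intro n' m' K' _ _ _ _ hmn νA νK W W' hWc hW'c M hM0 hW'b s hfinW
  exact integrable_pair_of_lintegral hmn νA νK hWc hW'c hM0 hW'b hfinW

end Main

end Summit.Langlands.Langlands.Theorems.GapGlobalTranslatePart2

end
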